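import Summits.Ventures.WeilGRH.MinorantZetaTransferOdd
import Summits.Ventures.WeilGRH.RungLogBounds
import Literature.Analysis.SpecialFunctions.MatsubaraSum
import HarnessLib

/-!
# GRH arm (rh-explicit, venture WeilGRH): the odd `ζ`-transfer floor law at the rungs of record

Cell `rh-explicit`, WEIL TRACK — GRH ARM (weil-grh-2 gen6; numerical leaves of `MinorantZetaTransferOdd.lean`).
With `E(t, γ) = sinh t + t + 2γt + γ² tanh(t/2)` and the odd law
`2E(t, γ) ≤ (1 − γ²) log q ⇒ WeilPositivityOnChar χ t` (odd `χ`, `ζ` positive on `[-t, t]`), the choices `γ = −1/2`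
(resp. `−47/100` at the frontier, `−23/50` at `t = 1`) and the elementary enclosures `sinh t ≤ (U − U⁻¹)/2`,
`tanh(t/2) ≤ (U − 1)/(U + 1)` for `e^t ≤ U` give the ODD floors (cell DATA = exact odd pseudo-key floors in brackets):
`(log 2)/2 ⇒ 3 [3]`, `2/5 ⇒ 4 [4]` (the deposit's row «2/5, odd, q₀ = 3» is the character `χ₃` itself — its census
encodes parity as `χ(q₀ − 1) = −1`, so `χ(2) = −1` there — not the all-trivial key; erratum weil-grh-2 gen6),
`(log 3)/2 ⇒ 6 [6]`, `59/100 ⇒ 7 [7]`, `log 2 ⇒ 10 [9]`, `18/25 ⇒ 11 [10]`,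
`3/4 ⇒ 12 [11]`, ★ `4023/5000 ⇒ 14 [14]` — all UNCONDITIONAL (`EvenWinsBeyondArch.weilPositivityOn_of_le_8046`) —
and the IMPLICATION `WeilPositivityOn 1 → (t = 1 for every odd χ mod q ≥ 31)` [data `30`].  The last section is
the CONDITIONAL LADDER above the frontier — what each future `ζ` rung hands the GRH arm by one `exact`
(even ∣ odd floors; data in brackets): `(log 5)/2 ⇒ 30 ∣ 14 [29 ∣ 14]`, `83/100 ⇒ 34 ∣ 16 [33 ∣ 15]`,
`9/10 ⇒ 48 ∣ 21 [46 ∣ 20]`, `(log 7)/2 ⇒ 68 ∣ 28`, `1 ⇒ 78 ∣ 31 [75 ∣ 30]` (the even `78` is `MinorantZetaTransfer.lean`).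
Everything is PROVED; no definitions, no named facts; RH/GRH-free.  References: A. Weil (1952), (10)–(11)
pp. 258–262 and the «lemme» p. 262 [Weil1952FormulesExplicites]; H. Yoshida (1992), §6 (6.2) [Yoshida1992].
-/

set_option autoImplicit false

noncomputable section

open Complex Set MeasureTheory Finset
open scoped Real

namespace Summit.Ventures.WeilGRH

open Literature.NumberTheory.LFunctions

variable {q : ℕ}

/-! ## Numerics: `tanh(t/2)` from `exp`, logarithms of the odd floors -/

/-- `tanh(t/2) ≤ (U − 1)/(U + 1)` when `e^t ≤ U`. [folklore] -/
theorem tanh_half_le_of_exp_le {t U : ℝ} (hU : Real.exp t ≤ U) : Real.tanh (t / 2) ≤ (U - 1) / (U + 1) := by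
  rw [Literature.Analysis.SpecialFunctions.tanh_half_eq t]
  have hE : 0 < Real.exp t := Real.exp_pos _
  have hU0 : 0 < U := hE.trans_le hU
  rw [div_le_div_iff₀ (by linarith) (by linarith)]
  nlinarith

/-- `log 7 ≥ (5 log 2 + log 3 + 2 log 5)/4` (`2400 ≤ 2401 = 7⁴`). [folklore] -/
theorem log_seven_ge_quarter : (5 * Real.log 2 + Real.log 3 + 2 * Real.log 5) / 4 ≤ Real.log 7 := by
  have h : Real.log 2400 ≤ Real.log 2401 := Real.log_le_log (by norm_num) (by norm_num)
  rw [show (2400 : ℝ) = 2 ^ 5 * 3 * 5 ^ 2 by norm_num, show (2401 : ℝ) = 7 ^ 4 by norm_num,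
    Real.log_mul (by norm_num) (by norm_num), Real.log_mul (by norm_num) (by norm_num), Real.log_pow,
    Real.log_pow, Real.log_pow] at h
  push_cast at h
  linarith

/-- `log 11 ≥ (3 log 2 + log 3 + log 5)/2` (`120 ≤ 121 = 11²`). [folklore] -/
theorem log_eleven_ge_half : (3 * Real.log 2 + Real.log 3 + Real.log 5) / 2 ≤ Real.log 11 := by
  have h : Real.log 120 ≤ Real.log 121 := Real.log_le_log (by norm_num) (by norm_num)
  rw [show (120 : ℝ) = 2 ^ 3 * 3 * 5 by norm_num, show (121 : ℝ) = 11 ^ 2 by norm_num,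
    Real.log_mul (by norm_num) (by norm_num), Real.log_mul (by norm_num) (by norm_num), Real.log_pow,
    Real.log_pow] at h
  push_cast at h
  linarith

/-- `log 31 ≥ (6 log 2 + log 3 + log 5)/2` (`960 ≤ 961 = 31²`). [folklore] -/
theorem log_thirtyone_ge_half : (6 * Real.log 2 + Real.log 3 + Real.log 5) / 2 ≤ Real.log 31 := by
  have h : Real.log 960 ≤ Real.log 961 := Real.log_le_log (by norm_num) (by norm_num)
  rw [show (960 : ℝ) = 2 ^ 6 * 3 * 5 by norm_num, show (961 : ℝ) = 31 ^ 2 by norm_num,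
    Real.log_mul (by norm_num) (by norm_num), Real.log_mul (by norm_num) (by norm_num), Real.log_pow,
    Real.log_pow] at h
  push_cast at h
  linarith

/-! ## The named odd floors (`γ = −1/2`, resp. `−47/100` at the frontier and `−23/50` at `t = 1`) -/

/-- Odd budget at the frontier: `2E(4023/5000, −47/100) ≤ (1 − 0.47²) log 14`. [folklore] -/
theorem odd_budget_frontier :
    2 * (Real.sinh (4023 / 5000) + 4023 / 5000 + 2 * (-47 / 100) * (4023 / 5000) +
      (-47 / 100) ^ 2 * Real.tanh (4023 / 5000 / 2)) ≤ (1 - (-47 / 100) ^ 2) * Real.log (14 : ℕ) := by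
  obtain ⟨-, he2⟩ := exp_frontier_bounds
  have hs := sinh_le_of_exp_le he2
  have hth := tanh_half_le_of_exp_le he2
  have h7 := log_seven_ge_quarter
  push_cast
  rw [show (14 : ℝ) = 2 * 7 by norm_num, Real.log_mul (by norm_num) (by norm_num)]
  nlinarith [Real.log_two_gt_d9, Real.log_three_gt_d9, Real.log_five_gt_d9]

/-- ★ `t = 4023/5000` (the `ζ` frontier): every ODD `χ` mod `q ≥ 14` — the cell's exact odd data floor.
[folklore] -/
theorem weilPositivityOnChar_frontier_of_odd_ge_fourteen (hq : 14 ≤ q) (χ : DirichletCharacter ℂ q)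
    (hodd : charParity χ = 1) : WeilPositivityOnChar χ (4023 / 5000) :=
  weilPositivityOnChar_odd_of_le_frontier_of_le (by norm_num) le_rfl (by norm_num) odd_budget_frontier hq χ hodd

/-- Odd budget at `3/4` (`γ = −1/2`): `≤ (3/4) log 12`. [folklore] -/
theorem odd_budget_three_quarters :
    2 * (Real.sinh (3 / 4) + 3 / 4 + 2 * (-1 / 2) * (3 / 4) + (-1 / 2) ^ 2 * Real.tanh (3 / 4 / 2)) ≤
      (1 - (-1 / 2) ^ 2) * Real.log (12 : ℕ) := by
  have hs := sinh_le_of_exp_le exp_three_quarters_le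
  have hth := tanh_half_le_of_exp_le exp_three_quarters_le
  push_cast
  rw [show (12 : ℝ) = 2 ^ 2 * 3 by norm_num, Real.log_mul (by norm_num) (by norm_num), Real.log_pow]
  push_cast
  nlinarith [Real.log_two_gt_d9, Real.log_three_gt_d9]

/-- ★ `t = 3/4`: every odd `χ` mod `q ≥ 12` (data floor `11`). [folklore] -/
theorem weilPositivityOnChar_three_quarters_of_odd_ge (hq : 12 ≤ q) (χ : DirichletCharacter ℂ q)
    (hodd : charParity χ = 1) : WeilPositivityOnChar χ (3 / 4) :=
  weilPositivityOnChar_odd_of_le_frontier_of_le (by norm_num) (by norm_num) (by norm_num)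
    odd_budget_three_quarters hq χ hodd

/-- Odd budget at `18/25` (`γ = −1/2`): `≤ (3/4) log 11`. [folklore] -/
theorem odd_budget_eighteen_twentyfifths :
    2 * (Real.sinh (18 / 25) + 18 / 25 + 2 * (-1 / 2) * (18 / 25) + (-1 / 2) ^ 2 * Real.tanh (18 / 25 / 2)) ≤
      (1 - (-1 / 2) ^ 2) * Real.log (11 : ℕ) := by
  have hs := sinh_le_of_exp_le exp_eighteen_twentyfifths_le
  have hth := tanh_half_le_of_exp_le exp_eighteen_twentyfifths_le
  have h11 := log_eleven_ge_half
  push_cast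
  nlinarith [Real.log_two_gt_d9, Real.log_three_gt_d9, Real.log_five_gt_d9]

/-- ★ `t = 18/25`: every odd `χ` mod `q ≥ 11` (data floor `10`). [folklore] -/
theorem weilPositivityOnChar_eighteen_twentyfifths_of_odd_ge (hq : 11 ≤ q) (χ : DirichletCharacter ℂ q)
    (hodd : charParity χ = 1) : WeilPositivityOnChar χ (18 / 25) :=
  weilPositivityOnChar_odd_of_le_frontier_of_le (by norm_num) (by norm_num) (by norm_num)
    odd_budget_eighteen_twentyfifths hq χ hodd

/-- Odd budget at `log 2` (`γ = −1/2`; `sinh(log 2) = 3/4`, `tanh((log 2)/2) = 1/3`): `5/3 ≤ (3/4) log 10`.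
[folklore] -/
theorem odd_budget_log_two :
    2 * (Real.sinh (Real.log 2) + Real.log 2 + 2 * (-1 / 2) * Real.log 2 +
      (-1 / 2) ^ 2 * Real.tanh (Real.log 2 / 2)) ≤ (1 - (-1 / 2) ^ 2) * Real.log (10 : ℕ) := by
  have hth := tanh_half_le_of_exp_le (le_of_eq (Real.exp_log (by norm_num : (0 : ℝ) < 2)))
  rw [sinh_log_two]
  push_cast
  rw [show (10 : ℝ) = 2 * 5 by norm_num, Real.log_mul (by norm_num) (by norm_num)]
  nlinarith [Real.log_two_gt_d9, Real.log_five_gt_d9]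

/-- ★ `t = log 2`: every odd `χ` mod `q ≥ 10` (data floor `9`). [folklore] -/
theorem weilPositivityOnChar_log_two_of_odd_ge (hq : 10 ≤ q) (χ : DirichletCharacter ℂ q)
    (hodd : charParity χ = 1) : WeilPositivityOnChar χ (Real.log 2) :=
  weilPositivityOnChar_odd_of_le_frontier_of_le (Real.log_pos (by norm_num)) (by linarith [Real.log_two_lt_d9])
    (by norm_num) odd_budget_log_two hq χ hodd

/-- Odd budget at `59/100` (`γ = −1/2`): `≤ (3/4) log 7`. [folklore] -/
theorem odd_budget_fiftynine :
    2 * (Real.sinh (59 / 100) + 59 / 100 + 2 * (-1 / 2) * (59 / 100) + (-1 / 2) ^ 2 * Real.tanh (59 / 100 / 2)) ≤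
      (1 - (-1 / 2) ^ 2) * Real.log (7 : ℕ) := by
  have hs := sinh_le_of_exp_le exp_fiftynine_hundredths_le
  have hth := tanh_half_le_of_exp_le exp_fiftynine_hundredths_le
  have h7 := log_seven_ge_quarter
  push_cast
  nlinarith [Real.log_two_gt_d9, Real.log_three_gt_d9, Real.log_five_gt_d9]

/-- ★ `t = 59/100`: every odd `χ` mod `q ≥ 7` — the cell's exact odd data floor. [folklore] -/
theorem weilPositivityOnChar_fiftynine_of_odd_ge (hq : 7 ≤ q) (χ : DirichletCharacter ℂ q)
    (hodd : charParity χ = 1) : WeilPositivityOnChar χ (59 / 100) :=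
  weilPositivityOnChar_odd_of_le_frontier_of_le (by norm_num) (by norm_num) (by norm_num)
    odd_budget_fiftynine hq χ hodd

/-- Odd budget at `(log 3)/2` (`γ = −1/2`): `≤ (3/4) log 6`. [folklore] -/
theorem odd_budget_log_three_half :
    2 * (Real.sinh (Real.log 3 / 2) + Real.log 3 / 2 + 2 * (-1 / 2) * (Real.log 3 / 2) +
      (-1 / 2) ^ 2 * Real.tanh (Real.log 3 / 2 / 2)) ≤ (1 - (-1 / 2) ^ 2) * Real.log (6 : ℕ) := by
  have hs := sinh_le_of_exp_le exp_log_three_half_le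
  have hth := tanh_half_le_of_exp_le exp_log_three_half_le
  push_cast
  rw [show (6 : ℝ) = 2 * 3 by norm_num, Real.log_mul (by norm_num) (by norm_num)]
  nlinarith [Real.log_two_gt_d9, Real.log_three_gt_d9, Real.log_three_lt_d9]

/-- ★ `t = (log 3)/2`: every odd `χ` mod `q ≥ 6` — the cell's exact odd data floor. [folklore] -/
theorem weilPositivityOnChar_log_three_half_of_odd_ge (hq : 6 ≤ q) (χ : DirichletCharacter ℂ q)
    (hodd : charParity χ = 1) : WeilPositivityOnChar χ (Real.log 3 / 2) :=
  weilPositivityOnChar_odd_of_le_frontier_of_le (by linarith [Real.log_three_gt_d9])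
    (by linarith [Real.log_three_lt_d9]) (by norm_num) odd_budget_log_three_half hq χ hodd

/-- Odd budget at `2/5` (`γ = −1/2`): `≤ (3/4) log 4`. [folklore] -/
theorem odd_budget_two_fifths :
    2 * (Real.sinh (2 / 5) + 2 / 5 + 2 * (-1 / 2) * (2 / 5) + (-1 / 2) ^ 2 * Real.tanh (2 / 5 / 2)) ≤
      (1 - (-1 / 2) ^ 2) * Real.log (4 : ℕ) := by
  have hs := sinh_le_of_exp_le exp_two_fifths_le
  have hth := tanh_half_le_of_exp_le exp_two_fifths_le
  push_cast
  rw [show (4 : ℝ) = 2 ^ 2 by norm_num, Real.log_pow]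
  push_cast
  nlinarith [Real.log_two_gt_d9]

/-- ★ `t = 2/5`: every odd `χ` mod `q ≥ 4` (data floor `3`). [folklore] -/
theorem weilPositivityOnChar_two_fifths_of_odd_ge (hq : 4 ≤ q) (χ : DirichletCharacter ℂ q)
    (hodd : charParity χ = 1) : WeilPositivityOnChar χ (2 / 5) :=
  weilPositivityOnChar_odd_of_le_frontier_of_le (by norm_num) (by norm_num) (by norm_num)
    odd_budget_two_fifths hq χ hodd

/-- Odd budget at `(log 2)/2` (`γ = −1/2`): `≤ (3/4) log 3`. [folklore] -/
theorem odd_budget_log_two_half :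
    2 * (Real.sinh (Real.log 2 / 2) + Real.log 2 / 2 + 2 * (-1 / 2) * (Real.log 2 / 2) +
      (-1 / 2) ^ 2 * Real.tanh (Real.log 2 / 2 / 2)) ≤ (1 - (-1 / 2) ^ 2) * Real.log (3 : ℕ) := by
  have hs := sinh_le_of_exp_le exp_log_two_half_le
  have hth := tanh_half_le_of_exp_le exp_log_two_half_le
  push_cast
  nlinarith [Real.log_two_gt_d9, Real.log_two_lt_d9, Real.log_three_gt_d9]

/-- ★ `t = (log 2)/2`: every odd `χ` mod `q ≥ 3` — the cell's exact odd data floor. [folklore] -/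
theorem weilPositivityOnChar_log_two_half_of_odd_ge (hq : 3 ≤ q) (χ : DirichletCharacter ℂ q)
    (hodd : charParity χ = 1) : WeilPositivityOnChar χ (Real.log 2 / 2) :=
  weilPositivityOnChar_odd_of_le_frontier_of_le (by linarith [Real.log_two_gt_d9])
    (by linarith [Real.log_two_lt_d9]) (by norm_num) odd_budget_log_two_half hq χ hodd

/-! ## Conditional: `ζ`'s rung `t = 1` would give every odd character of modulus `≥ 31` -/

/-- Odd budget at `t = 1` (`γ = −23/50`): `≤ (1 − 0.46²) log 31` (margin `10⁻³`; the exact odd pseudo-key floor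
at `t = 1` is `30`). [folklore] -/
theorem odd_budget_one :
    2 * (Real.sinh 1 + 1 + 2 * (-23 / 50) * 1 + (-23 / 50) ^ 2 * Real.tanh (1 / 2)) ≤
      (1 - (-23 / 50) ^ 2) * Real.log (31 : ℕ) := by
  have hs := sinh_le_of_exp_le Real.exp_one_lt_d9.le
  have hth := tanh_half_le_of_exp_le Real.exp_one_lt_d9.le
  have h31 := log_thirtyone_ge_half
  push_cast
  nlinarith [Real.log_two_gt_d9, Real.log_three_gt_d9, Real.log_five_gt_d9]

/-- ★★ **`WeilPositivityOn 1 → t = 1 for every ODD Dirichlet character of every modulus `q ≥ 31`.**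
An implication, not a claim that either side holds. [cite: Weil1952FormulesExplicites, the «lemme» p. 262] -/
theorem weilPositivityOnChar_one_of_odd_of_weilPositivityOn_one (hζ : WeilPositivityOn 1) (hq : 31 ≤ q)
    (χ : DirichletCharacter ℂ q) (hodd : charParity χ = 1) : WeilPositivityOnChar χ 1 :=
  weilPositivityOnChar_odd_of_weilPositivityOn_of_le one_pos hζ (by norm_num) odd_budget_one hq χ hodd

/-! ## The conditional ladder above the frontier: the GRH dividend of each future `ζ` rung -/

/-- `e^{(log 5)/2} ≤ 2.236068` (its square is `5`). [folklore] -/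
theorem exp_log_five_half_le : Real.exp (Real.log 5 / 2) ≤ 2.236068 := by
  have hsq : Real.exp (Real.log 5 / 2) * Real.exp (Real.log 5 / 2) = 5 := by
    rw [← Real.exp_add, add_halves, Real.exp_log (by norm_num)]
  have hE : 0 < Real.exp (Real.log 5 / 2) := Real.exp_pos _
  nlinarith

/-- `(log 5)/2` (conditional on the `ζ` rung R4d): even budget `2(sinh t + t) ≤ log 30`. [folklore] -/
theorem two_mul_sinh_add_log_five_half_le_log :
    2 * (Real.sinh (Real.log 5 / 2) + Real.log 5 / 2) ≤ Real.log (30 : ℕ) := by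
  have hs := sinh_le_of_exp_le exp_log_five_half_le
  have hl := log_thirty_ge
  have h5 := Real.log_five_lt_d9
  push_cast
  nlinarith

/-- `(log 5)/2`: odd budget (`γ = −47/100`) `≤ (1 − 0.47²) log 14`. [folklore] -/
theorem odd_budget_log_five_half :
    2 * (Real.sinh (Real.log 5 / 2) + Real.log 5 / 2 + 2 * (-47 / 100) * (Real.log 5 / 2) +
      (-47 / 100) ^ 2 * Real.tanh (Real.log 5 / 2 / 2)) ≤ (1 - (-47 / 100) ^ 2) * Real.log (14 : ℕ) := by
  have hs := sinh_le_of_exp_le exp_log_five_half_le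
  have hth := tanh_half_le_of_exp_le exp_log_five_half_le
  have h7 := log_seven_ge_quarter
  have h5 := Real.log_five_lt_d9
  have h5' := Real.log_five_gt_d9
  push_cast
  rw [show (14 : ℝ) = 2 * 7 by norm_num, Real.log_mul (by norm_num) (by norm_num)]
  nlinarith [Real.log_two_gt_d9, Real.log_three_gt_d9]

/-- ★ `WeilPositivityOn ((log 5)/2) →` every `χ` mod `q ≥ 30` and every ODD `χ` mod `q ≥ 14` at `(log 5)/2`.
An implication (the `ζ` rung `(log 5)/2` is not in the tree at the time of writing). [folklore] -/
theorem weilPositivityOnChar_log_five_half_of_weilPositivityOn (hζ : WeilPositivityOn (Real.log 5 / 2))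
    (χ : DirichletCharacter ℂ q) :
    (30 ≤ q → WeilPositivityOnChar χ (Real.log 5 / 2)) ∧
      (14 ≤ q → charParity χ = 1 → WeilPositivityOnChar χ (Real.log 5 / 2)) := by
  have ht : 0 < Real.log 5 / 2 := by linarith [Real.log_five_gt_d9]
  exact ⟨fun hq ↦ weilPositivityOnChar_of_weilPositivityOn_of_le ht hζ two_mul_sinh_add_log_five_half_le_log hq χ,
    fun hq hodd ↦ weilPositivityOnChar_odd_of_weilPositivityOn_of_le ht hζ (by norm_num)
      odd_budget_log_five_half hq χ hodd⟩

/-- `e^{83/100} ≤ 2.2934` and `e^{9/10} ≤ 2.4597`. [folklore] -/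
theorem exp_eightythree_le_and_exp_nine_tenths_le : Real.exp (83 / 100) ≤ 2.2934 ∧ Real.exp (9 / 10) ≤ 2.4597 := by
  have h := exp_le_taylor_ten (x := 83 / 100) (by norm_num) (by norm_num)
  have h' := exp_le_taylor_ten (x := 9 / 10) (by norm_num) (by norm_num)
  simp only [sum_range_succ, sum_range_zero, Nat.factorial] at h h'
  norm_num at h h'
  constructor <;> linarith

/-- `log 17 ≥ (5 log 2 + 2 log 3)/2` (`288 ≤ 289 = 17²`). [folklore] -/
theorem log_seventeen_ge_half : (5 * Real.log 2 + 2 * Real.log 3) / 2 ≤ Real.log 17 := by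
  have h : Real.log 288 ≤ Real.log 289 := Real.log_le_log (by norm_num) (by norm_num)
  rw [show (288 : ℝ) = 2 ^ 5 * 3 ^ 2 by norm_num, show (289 : ℝ) = 17 ^ 2 by norm_num,
    Real.log_mul (by norm_num) (by norm_num), Real.log_pow, Real.log_pow, Real.log_pow] at h
  push_cast at h
  linarith

/-- `83/100` (conditional on the `ζ` rung W-M2): even budget `≤ log 34`, odd budget (`γ = −47/100`) `≤ (1 − 0.47²) log 16`.
[folklore] -/
theorem budgets_eightythree :
    2 * (Real.sinh (83 / 100) + 83 / 100) ≤ Real.log (34 : ℕ) ∧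
      2 * (Real.sinh (83 / 100) + 83 / 100 + 2 * (-47 / 100) * (83 / 100) +
        (-47 / 100) ^ 2 * Real.tanh (83 / 100 / 2)) ≤ (1 - (-47 / 100) ^ 2) * Real.log (16 : ℕ) := by
  have hs := sinh_le_of_exp_le exp_eightythree_le_and_exp_nine_tenths_le.1
  have hth := tanh_half_le_of_exp_le exp_eightythree_le_and_exp_nine_tenths_le.1
  have h17 := log_seventeen_ge_half
  have hl2 := Real.log_two_gt_d9
  have hl3 := Real.log_three_gt_d9
  push_cast
  rw [show (34 : ℝ) = 2 * 17 by norm_num, Real.log_mul (by norm_num) (by norm_num),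
    show (16 : ℝ) = 2 ^ 4 by norm_num, Real.log_pow]
  push_cast
  constructor <;> nlinarith

/-- ★ `WeilPositivityOn (83/100) →` every `χ` mod `q ≥ 34` and every odd `χ` mod `q ≥ 16` at `83/100`
(data floors `33 ∣ 15`). [folklore] -/
theorem weilPositivityOnChar_eightythree_of_weilPositivityOn (hζ : WeilPositivityOn (83 / 100))
    (χ : DirichletCharacter ℂ q) :
    (34 ≤ q → WeilPositivityOnChar χ (83 / 100)) ∧
      (16 ≤ q → charParity χ = 1 → WeilPositivityOnChar χ (83 / 100)) :=
  ⟨fun hq ↦ weilPositivityOnChar_of_weilPositivityOn_of_le (by norm_num) hζ budgets_eightythree.1 hq χ,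
    fun hq hodd ↦ weilPositivityOnChar_odd_of_weilPositivityOn_of_le (by norm_num) hζ (by norm_num)
      budgets_eightythree.2 hq χ hodd⟩

/-- `9/10` (conditional): even budget `≤ log 48`, odd budget (`γ = −47/100`) `≤ (1 − 0.47²) log 21`. [folklore] -/
theorem budgets_nine_tenths :
    2 * (Real.sinh (9 / 10) + 9 / 10) ≤ Real.log (48 : ℕ) ∧
      2 * (Real.sinh (9 / 10) + 9 / 10 + 2 * (-47 / 100) * (9 / 10) +
        (-47 / 100) ^ 2 * Real.tanh (9 / 10 / 2)) ≤ (1 - (-47 / 100) ^ 2) * Real.log (21 : ℕ) := by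
  have hs := sinh_le_of_exp_le exp_eightythree_le_and_exp_nine_tenths_le.2
  have hth := tanh_half_le_of_exp_le exp_eightythree_le_and_exp_nine_tenths_le.2
  have h7 := log_seven_ge_quarter
  have hl2 := Real.log_two_gt_d9
  have hl3 := Real.log_three_gt_d9
  have hl5 := Real.log_five_gt_d9
  push_cast
  rw [show (48 : ℝ) = 2 ^ 4 * 3 by norm_num, Real.log_mul (by norm_num) (by norm_num), Real.log_pow,
    show (21 : ℝ) = 3 * 7 by norm_num, Real.log_mul (by norm_num) (by norm_num)]
  push_cast
  constructor <;> nlinarith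

/-- ★ `WeilPositivityOn (9/10) →` every `χ` mod `q ≥ 48` and every odd `χ` mod `q ≥ 21` at `9/10`
(data floors `46 ∣ 20`). [folklore] -/
theorem weilPositivityOnChar_nine_tenths_of_weilPositivityOn (hζ : WeilPositivityOn (9 / 10))
    (χ : DirichletCharacter ℂ q) :
    (48 ≤ q → WeilPositivityOnChar χ (9 / 10)) ∧
      (21 ≤ q → charParity χ = 1 → WeilPositivityOnChar χ (9 / 10)) :=
  ⟨fun hq ↦ weilPositivityOnChar_of_weilPositivityOn_of_le (by norm_num) hζ budgets_nine_tenths.1 hq χ,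
    fun hq hodd ↦ weilPositivityOnChar_odd_of_weilPositivityOn_of_le (by norm_num) hζ (by norm_num)
      budgets_nine_tenths.2 hq χ hodd⟩

/-- `e^{(log 7)/2} ≤ 2.645752` (its square is `7`). [folklore] -/
theorem exp_log_seven_half_le : Real.exp (Real.log 7 / 2) ≤ 2.645752 := by
  have hsq : Real.exp (Real.log 7 / 2) * Real.exp (Real.log 7 / 2) = 7 := by
    rw [← Real.exp_add, add_halves, Real.exp_log (by norm_num)]
  have hE : 0 < Real.exp (Real.log 7 / 2) := Real.exp_pos _
  nlinarith

/-- `(log 7)/2` (conditional on W-M3): even budget `≤ log 68`, odd budget (`γ = −23/50`) `≤ (1 − 0.46²) log 28`.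
[folklore] -/
theorem budgets_log_seven_half :
    2 * (Real.sinh (Real.log 7 / 2) + Real.log 7 / 2) ≤ Real.log (68 : ℕ) ∧
      2 * (Real.sinh (Real.log 7 / 2) + Real.log 7 / 2 + 2 * (-23 / 50) * (Real.log 7 / 2) +
        (-23 / 50) ^ 2 * Real.tanh (Real.log 7 / 2 / 2)) ≤ (1 - (-23 / 50) ^ 2) * Real.log (28 : ℕ) := by
  have hs := sinh_le_of_exp_le exp_log_seven_half_le
  have hth := tanh_half_le_of_exp_le exp_log_seven_half_le
  have h7 := log_seven_ge_quarter
  have h7u := log_seven_le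
  have h17 := log_seventeen_ge_half
  have hl2 := Real.log_two_gt_d9
  have hl3 := Real.log_three_gt_d9
  have hl5 := Real.log_five_gt_d9
  push_cast
  rw [show (68 : ℝ) = 2 ^ 2 * 17 by norm_num, Real.log_mul (by norm_num) (by norm_num), Real.log_pow,
    show (28 : ℝ) = 2 ^ 2 * 7 by norm_num, Real.log_mul (by norm_num) (by norm_num), Real.log_pow]
  push_cast
  constructor <;> nlinarith

/-- ★ `WeilPositivityOn ((log 7)/2) →` every `χ` mod `q ≥ 68` and every odd `χ` mod `q ≥ 28` at `(log 7)/2`.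
[folklore] -/
theorem weilPositivityOnChar_log_seven_half_of_weilPositivityOn (hζ : WeilPositivityOn (Real.log 7 / 2))
    (χ : DirichletCharacter ℂ q) :
    (68 ≤ q → WeilPositivityOnChar χ (Real.log 7 / 2)) ∧
      (28 ≤ q → charParity χ = 1 → WeilPositivityOnChar χ (Real.log 7 / 2)) := by
  have ht : 0 < Real.log 7 / 2 := by
    have : (1 : ℝ) < 7 := by norm_num
    have := Real.log_pos this
    linarith
  exact ⟨fun hq ↦ weilPositivityOnChar_of_weilPositivityOn_of_le ht hζ budgets_log_seven_half.1 hq χ,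
    fun hq hodd ↦ weilPositivityOnChar_odd_of_weilPositivityOn_of_le ht hζ (by norm_num)
      budgets_log_seven_half.2 hq χ hodd⟩

end Summit.Ventures.WeilGRH

end
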